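import Summits.MatrixMultiplication.OmegaCensus.StrongUSPOmegaBound
import Literature.Computability.AlgebraicComplexity.StrongUSPTriangle
import HarnessLib

/-!
# ω-census, family (b′) STPP / USP: CKSU's "strong USP capacity ≥ 2^{2/3}, hence ω < 2.48" as a theorem

HONEST FRAMING (pub-omega census; verbatim): lottery ticket; floor = certified bounds/negative ranges.
Census BOOKKEEPING for the Cohn–Umans STPP / USP track, not progress on `ω` (the tree proves `ω < 2.373` by the
laser method).  This file re-derives, END-TO-END IN THE KERNEL, the best printed ω-bound of the strong-USP method:
Cohn–Kleinberg–Szegedy–Umans 2005, Proposition 3.8 / 18: "It follows that the strong USP capacity is at least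
`2^{2/3}` and `ω < 2.48`" (census control row R28, value `2.4785`, previously certified by engines only).

Chain (all tree theorems, 0 facts): `isStrongUSP_cksuTriangleUSP k` (CKSU Prop. 3.8 / 18: the triangle strong USP of
`2^{k−1}(2^k+1)` rows and width `3k`, resting on the Cohn–Umans 2003 triangle theorem `TriPt.triangle_tpp`;
`Literature/…/StrongUSPTriangle.lean`) → `omega_le_of_isStrongUSP` (CKSU Cor. 3.6 / 16, `StrongUSPOmegaBound.lean`)
→ `log s! ≥ s log s − s`, `s ≥ 2^{2k−1}` → for every `k ≥ 1`, `m ≥ 3`: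
`ω ≤ 3 (log m − (2/3) log 2 + (log 2 + 1)/(3k)) / log(m − 1)` (`omega_le_of_cksuTriangleUSP`) → `k → ∞`:
`ω ≤ 3 (log m − (2/3) log 2) / log(m − 1)` (`omega_le_cksu_prop18_limit`; at `m = 6`: `2.4784951…`) →
`ω ≤ 2.4785` (`omega_le_of_cksuProp18_m6`, certificate `3^30000 · 2^10000 ≤ 5^24785`) → `ω ≤ 2.48` as printed
(`omega_le_of_cksuProp18`).

## References
* H. Cohn, R. Kleinberg, B. Szegedy, C. Umans, *Group-theoretic algorithms for matrix multiplication*, FOCS 2005;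
  arXiv:math/0511460, §3: Proposition 18 (p. 7), Corollary 16 (p. 6). [CohnKleinbergSzegedyUmans2005]
* H. Cohn, C. Umans, *A group-theoretic approach to fast matrix multiplication*, FOCS 2003; arXiv:math/0307321,
  Theorem 6. [CohnUmans2003]
-/

noncomputable section

namespace Summit.MatrixMultiplication.OmegaCensus

open Literature.Computability.AlgebraicComplexity

/-- Stirling from below: `s log s ≤ log s! + s` (from `s^s / s! ≤ e^s`). [folklore] -/
private theorem mul_log_le_log_factorial_add (s : ℕ) :
    (s : ℝ) * Real.log s ≤ Real.log (Nat.factorial s : ℕ) + s := by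
  have hf : (0 : ℝ) < (Nat.factorial s : ℕ) := by exact_mod_cast Nat.factorial_pos s
  have h := Real.pow_div_factorial_le_exp (s : ℝ) (Nat.cast_nonneg s) s
  rw [div_le_iff₀ hf] at h
  rcases Nat.eq_zero_or_pos s with hs | hs
  · subst hs; simp
  have hpos : (0 : ℝ) < (s : ℝ) ^ s := by positivity
  have hlog := Real.log_le_log hpos h
  rw [Real.log_pow, Real.log_mul (Real.exp_pos _).ne' hf.ne', Real.log_exp] at hlog
  linarith

/-- **CKSU Proposition 3.8 / 18 fed to Corollary 3.6 / 16, finite `k`**: for every `k ≥ 1` and `m ≥ 3`,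
`ω ≤ 3 (log m − (2/3) log 2 + (log 2 + 1)/(3k)) / log (m − 1)` — from `omega_le_of_isStrongUSP` for the strong
USP `cksuTriangleUSP k` (`s = 2^{k−1}(2^k+1)` rows, width `3k`), `log s! ≥ s log s − s` and `s ≥ 2^{2k−1}`.
[cite: CohnKleinbergSzegedyUmans2005, Proposition 18 and Corollary 16 (§3)] -/
theorem omega_le_of_cksuTriangleUSP (k : ℕ) (hk : 1 ≤ k) {m : ℕ} (hm : 3 ≤ m) :
    omega ℂ ≤ 3 * (Real.log m - 2 * Real.log 2 / 3 + (Real.log 2 + 1) / (3 * k)) / Real.log ((m : ℝ) - 1) := by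
  -- the size `s` of the triangle puzzle and the facts we need about it
  have h2s : 2 * Fintype.card (TriPt (2 ^ k)) = 2 ^ k * (2 ^ k + 1) := TriPt.two_mul_card (2 ^ k)
  set s : ℕ := Fintype.card (TriPt (2 ^ k)) with hsdef
  have hspos : 0 < s := by
    have : 0 < 2 ^ k * (2 ^ k + 1) := by positivity
    omega
  have h0 := omega_le_of_isStrongUSP (isStrongUSP_cksuTriangleUSP k) hspos (by omega : 0 < k + k + k) hm
  -- real-number bookkeeping
  have hkpos : (0 : ℝ) < k := by exact_mod_cast hk
  have hL : 0 < Real.log ((m : ℝ) - 1) := by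
    apply Real.log_pos
    have : (3 : ℝ) ≤ m := by exact_mod_cast hm
    linarith
  have hSpos : (0 : ℝ) < s := by exact_mod_cast hspos
  have hN : (((s * (k + k + k) : ℕ) : ℝ)) = (s : ℝ) * (3 * k) := by push_cast; ring
  rw [hN] at h0
  -- log s ≥ (2k − 1) log 2, from 2 s = 2^k (2^k + 1) ≥ 2^(2k) = 2 · 2^(2k−1)
  have hs_ge : (2 : ℝ) ^ (2 * k - 1) ≤ s := by
    have hnat : 2 ^ (2 * k - 1) ≤ s := by
      have e : 2 * 2 ^ (2 * k - 1) = 2 ^ k * 2 ^ k := by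
        rw [← pow_succ', ← pow_add]; congr 1; omega
      nlinarith [Nat.one_le_two_pow (n := k)]
    exact_mod_cast hnat
  have hlogs : ((2 * k - 1 : ℕ) : ℝ) * Real.log 2 ≤ Real.log s := by
    rw [← Real.log_pow]
    exact Real.log_le_log (by positivity) hs_ge
  have hcast : ((2 * k - 1 : ℕ) : ℝ) = 2 * k - 1 := by
    rw [Nat.cast_sub (by omega), Nat.cast_mul]; norm_num
  rw [hcast] at hlogs
  -- log s! ≥ s log s − s ≥ s ((2k−1) log 2 − 1)
  have hfact := mul_log_le_log_factorial_add s
  have hfact' : (s : ℝ) * ((2 * k - 1) * Real.log 2) - s ≤ Real.log ((Nat.factorial s : ℕ) : ℝ) := by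
    nlinarith [hlogs, hSpos.le]
  refine h0.trans ?_
  rw [div_le_div_iff₀ (by positivity) hL]
  have hkey : (s : ℝ) * (3 * k) * Real.log m - Real.log ((Nat.factorial s : ℕ) : ℝ) ≤
      (Real.log m - 2 * Real.log 2 / 3 + (Real.log 2 + 1) / (3 * k)) * ((s : ℝ) * (3 * k)) := by
    have e : (Real.log m - 2 * Real.log 2 / 3 + (Real.log 2 + 1) / (3 * k)) * ((s : ℝ) * (3 * k)) =
        (s : ℝ) * (3 * k) * Real.log m - ((s : ℝ) * ((2 * k - 1) * Real.log 2) - s) := by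
      field_simp; ring
    rw [e]
    linarith
  nlinarith [hkey, hL]

/-- **CKSU: "the strong USP capacity is at least `2^{2/3}` and `ω < 2.48`" — the limit `k → ∞` as a closed form**:
for every `m ≥ 3`, `ω ≤ 3 (log m − (2/3) log 2) / log (m − 1)` (at `m = 6`: `2.4784951…`, census control row R28).
[cite: CohnKleinbergSzegedyUmans2005, Proposition 18 (§3.4, p. 7): "It follows that the strong USP capacity is at least 2^{2/3} and ω < 2.48"] -/
theorem omega_le_cksu_prop18_limit {m : ℕ} (hm : 3 ≤ m) :
    omega ℂ ≤ 3 * (Real.log m - 2 * Real.log 2 / 3) / Real.log ((m : ℝ) - 1) := by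
  have hL : 0 < Real.log ((m : ℝ) - 1) := by
    apply Real.log_pos
    have : (3 : ℝ) ≤ m := by exact_mod_cast hm
    linarith
  have hc : 0 < Real.log 2 + 1 := by have := Real.log_pos (by norm_num : (1 : ℝ) < 2); linarith
  apply le_of_forall_pos_lt_add
  intro ε hε
  obtain ⟨k, hk⟩ := exists_nat_gt ((Real.log 2 + 1) / (ε * Real.log ((m : ℝ) - 1)))
  have hkpos : (0 : ℝ) < k := lt_of_le_of_lt (by positivity) hk
  have hk1 : 1 ≤ k := by exact_mod_cast hkpos
  have h := omega_le_of_cksuTriangleUSP k hk1 hm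
  have hsplit : 3 * (Real.log m - 2 * Real.log 2 / 3 + (Real.log 2 + 1) / (3 * k)) / Real.log ((m : ℝ) - 1) =
      3 * (Real.log m - 2 * Real.log 2 / 3) / Real.log ((m : ℝ) - 1)
        + (Real.log 2 + 1) / (k * Real.log ((m : ℝ) - 1)) := by
    field_simp
  rw [hsplit] at h
  have hsmall : (Real.log 2 + 1) / (k * Real.log ((m : ℝ) - 1)) < ε := by
    rw [div_lt_iff₀ (by positivity)]
    rw [div_lt_iff₀ (by positivity)] at hk
    nlinarith [hk, hL, hε, hc]
  linarith

/-- Census control row R28 at KERNEL grade: **`ω ≤ 2.4785` by the group-theoretic method from CKSU's strong USP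
family of Proposition 3.8 / 18 with `m = 6`** (printed: "the strong USP capacity is at least `2^{2/3}` and
`ω < 2.48`"; exact limit value `3 (log 6 − (2/3) log 2)/log 5 = 2.4784951…`; decimal certificate
`3^30000 · 2^10000 ≤ 5^24785`, i.e. `30000 log 3 + 10000 log 2 ≤ 24785 log 5`; `2.4784` fails).  Not a competitive
bound (the tree has `ω < 2.373`); it is CKSU's best strong-USP bound re-derived end-to-end as a theorem.
[cite: CohnKleinbergSzegedyUmans2005, Proposition 18 (§3.4, p. 7) + Corollary 16] -/
theorem omega_le_of_cksuProp18_m6 : omega ℂ ≤ 2.4785 := by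
  have h := omega_le_cksu_prop18_limit (m := 6) (by norm_num)
  have h6 : Real.log ((6 : ℕ) : ℝ) = Real.log 2 + Real.log 3 := by
    rw [show ((6 : ℕ) : ℝ) = 2 * 3 by norm_num, Real.log_mul (by norm_num) (by norm_num)]
  have h5 : Real.log (((6 : ℕ) : ℝ) - 1) = Real.log 5 := by norm_num
  rw [h6, h5] at h
  have hlog5 : 0 < Real.log 5 := Real.log_pos (by norm_num)
  have hpow : (3 : ℝ) ^ 30000 * (2 : ℝ) ^ 10000 ≤ (5 : ℝ) ^ 24785 := by
    have : (3 ^ 30000 * 2 ^ 10000 : ℕ) ≤ 5 ^ 24785 := by decide +kernel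
    exact_mod_cast this
  have hlogs : 30000 * Real.log 3 + 10000 * Real.log 2 ≤ 24785 * Real.log 5 := by
    have := Real.log_le_log (by positivity) hpow
    rwa [Real.log_mul (by positivity) (by positivity), Real.log_pow, Real.log_pow, Real.log_pow] at this
  refine h.trans ?_
  rw [div_le_iff₀ hlog5]
  nlinarith [hlogs, hlog5]

/-- The printed form: **`ω < 2.48` from strong USPs** (CKSU 2005 §3.4), as `ω ≤ 2.48`.
[cite: CohnKleinbergSzegedyUmans2005, Proposition 18 (§3.4, p. 7)] -/
theorem omega_le_of_cksuProp18 : omega ℂ ≤ 2.48 :=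
  omega_le_of_cksuProp18_m6.trans (by norm_num)

end Summit.MatrixMultiplication.OmegaCensus

end
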